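import Mathlib

/-!
# P6AokiQuotientCard — the cardinality corollary of the two-part structure statement

For ℤ-submodules `SD ≤ B` of a ℤ-module `V` and vectors `β : Fin k → V` with
`B = SD ⊔ span β` and «`Σ c_j • β_j ∈ SD` iff every `c_j` is even», the quotient
`B ⧸ (SD ∩ B)` is ℤ-linearly isomorphic to `(ℤ/2)^k`, hence has `2 ^ k` elements.
These are exactly the parts (2)–(3) of the level theorems `L<q>.main` of the
`P6AokiQuotient` modules (Aoki's quotient `B_q/(S_q + D_q)`), so the instances
`Nat.card (B q ⧸ (SD q).comap (B q).subtype) = 2 ^ k` follow at every certified level.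
Pure finite linear algebra over ℤ (R-5); nothing here is an algebraicity statement.
-/

namespace HodgeRepro0.P6AokiQuotient

/-- The reduction map `ℤ^k → (ℤ/2)^k`, coordinatewise `Int.cast`. -/
def modTwoMap (k : ℕ) : (Fin k → ℤ) →ₗ[ℤ] (Fin k → ZMod 2) :=
  LinearMap.compLeft (Int.castAddHom (ZMod 2)).toIntLinearMap (Fin k)

/-- `modTwoMap` applied to `c` is `fun j => (c j : ZMod 2)`. -/
theorem modTwoMap_apply (k : ℕ) (c : Fin k → ℤ) : modTwoMap k c = fun j => (c j : ZMod 2) := rfl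

/-- The kernel of `modTwoMap k` is the set of vectors with every coordinate even. -/
theorem mem_ker_modTwoMap (k : ℕ) (c : Fin k → ℤ) :
    c ∈ LinearMap.ker (modTwoMap k) ↔ ∀ j, (2 : ℤ) ∣ c j := by
  rw [LinearMap.mem_ker, modTwoMap_apply, funext_iff]
  refine forall_congr' fun j => ?_
  rw [Pi.zero_apply, ZMod.intCast_zmod_eq_zero_iff_dvd]
  norm_num

/-- `modTwoMap k` is surjective (every class of `ℤ/2` is the cast of an integer). -/
theorem modTwoMap_surjective (k : ℕ) : Function.Surjective (modTwoMap k) := by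
  intro f
  refine ⟨fun j => (ZMod.cast (f j) : ℤ), ?_⟩
  rw [modTwoMap_apply]
  funext j
  exact ZMod.intCast_zmod_cast (f j)

/-- `ℤ^k ⧸ (2ℤ)^k ≃ (ℤ/2)^k` as ℤ-modules, via `modTwoMap`. -/
noncomputable def quotModTwoEquiv (k : ℕ) :
    ((Fin k → ℤ) ⧸ LinearMap.ker (modTwoMap k)) ≃ₗ[ℤ] (Fin k → ZMod 2) :=
  (modTwoMap k).quotKerEquivOfSurjective (modTwoMap_surjective k)

/-- `(ℤ/2)^k` has `2 ^ k` elements. -/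
theorem card_fin_zmod_two (k : ℕ) : Nat.card (Fin k → ZMod 2) = 2 ^ k := by
  rw [Nat.card_eq_fintype_card, Fintype.card_fun, ZMod.card 2, Fintype.card_fin]

section General

variable {V : Type*} [AddCommGroup V]

/-- Every `β_j` lies in `B` when `B = SD ⊔ span β`. -/
theorem mem_of_eq_sup_span {SD B : Submodule ℤ V} {k : ℕ} {β : Fin k → V}
    (hB : B = SD ⊔ Submodule.span ℤ (Set.range β)) (j : Fin k) : β j ∈ B := by
  rw [hB]
  exact Submodule.mem_sup_right (Submodule.subset_span ⟨j, rfl⟩)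

/-- Every combination `Σ c_j • β_j` lies in `B` when `B = SD ⊔ span β`. -/
theorem sum_smul_mem_of_eq_sup_span {SD B : Submodule ℤ V} {k : ℕ} {β : Fin k → V}
    (hB : B = SD ⊔ Submodule.span ℤ (Set.range β)) (c : Fin k → ℤ) :
    (∑ j, c j • β j) ∈ B :=
  Submodule.sum_mem _ fun j _ => Submodule.smul_mem _ _ (mem_of_eq_sup_span hB j)

/-- The combination map `ℤ^k → B`, `c ↦ Σ c_j • β_j` (codomain restricted to `B`). -/
noncomputable def combMap {SD B : Submodule ℤ V} {k : ℕ} (β : Fin k → V)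
    (hB : B = SD ⊔ Submodule.span ℤ (Set.range β)) : (Fin k → ℤ) →ₗ[ℤ] B :=
  LinearMap.codRestrict B (Fintype.linearCombination ℤ β) fun c => by
    rw [Fintype.linearCombination_apply]
    exact sum_smul_mem_of_eq_sup_span hB c

/-- The value of `combMap` in `V`. -/
theorem coe_combMap_apply {SD B : Submodule ℤ V} {k : ℕ} (β : Fin k → V)
    (hB : B = SD ⊔ Submodule.span ℤ (Set.range β)) (c : Fin k → ℤ) :
    ((combMap β hB c : B) : V) = ∑ j, c j • β j := by
  simp [combMap, LinearMap.codRestrict_apply, Fintype.linearCombination_apply]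

/-- The quotient map `ℤ^k → B ⧸ (SD ∩ B)`, `c ↦ [Σ c_j • β_j]`. -/
noncomputable def quotMap {SD B : Submodule ℤ V} {k : ℕ} (β : Fin k → V)
    (hB : B = SD ⊔ Submodule.span ℤ (Set.range β)) :
    (Fin k → ℤ) →ₗ[ℤ] (B ⧸ SD.comap B.subtype) :=
  (SD.comap B.subtype).mkQ ∘ₗ combMap β hB

/-- The value of `quotMap` is the class of `combMap`. -/
theorem quotMap_apply {SD B : Submodule ℤ V} {k : ℕ} (β : Fin k → V)
    (hB : B = SD ⊔ Submodule.span ℤ (Set.range β)) (c : Fin k → ℤ) :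
    quotMap β hB c = Submodule.Quotient.mk (combMap β hB c) := rfl

/-- THE QUOTIENT MAP is surjective when `B = SD ⊔ span β`
(every `v ∈ B` is `s + Σ c_j • β_j` with `s ∈ SD`). -/
theorem quotMap_surjective {SD B : Submodule ℤ V} {k : ℕ} (β : Fin k → V)
    (hB : B = SD ⊔ Submodule.span ℤ (Set.range β)) :
    Function.Surjective (quotMap β hB) := by
  intro x
  obtain ⟨v, rfl⟩ := Submodule.mkQ_surjective _ x
  have hv : (v : V) ∈ SD ⊔ Submodule.span ℤ (Set.range β) := hB ▸ v.2
  rw [Submodule.mem_sup] at hv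
  obtain ⟨s, hs, w, hw, hsw⟩ := hv
  obtain ⟨c, rfl⟩ := (Submodule.mem_span_range_iff_exists_fun ℤ).mp hw
  refine ⟨c, ?_⟩
  rw [quotMap_apply, Submodule.mkQ_apply, Submodule.Quotient.eq, Submodule.mem_comap,
    Submodule.subtype_apply, Submodule.coe_sub, coe_combMap_apply]
  have : (∑ j, c j • β j) - (v : V) = -s := by rw [← hsw]; abel
  rw [this]
  exact SD.neg_mem hs

/-- THE KERNEL of the quotient map is `(2ℤ)^k` when the relations of the `β_j` modulo `SD`
are exactly «every coefficient even». -/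
theorem ker_quotMap {SD B : Submodule ℤ V} {k : ℕ} (β : Fin k → V)
    (hB : B = SD ⊔ Submodule.span ℤ (Set.range β))
    (hrel : ∀ c : Fin k → ℤ, (∑ j, c j • β j) ∈ SD ↔ ∀ j, 2 ∣ c j) :
    LinearMap.ker (quotMap β hB) = LinearMap.ker (modTwoMap k) := by
  ext c
  rw [mem_ker_modTwoMap, LinearMap.mem_ker, quotMap_apply, Submodule.Quotient.mk_eq_zero,
    Submodule.mem_comap, Submodule.subtype_apply, coe_combMap_apply]
  exact hrel c

/-- THE STRUCTURE: `B ⧸ (SD ∩ B) ≃ₗ[ℤ] (ℤ/2)^k` from `B = SD ⊔ span β` and the relation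
criterion (parts (2)–(3) of the level theorems). -/
noncomputable def quotientEquivModTwo {SD B : Submodule ℤ V} {k : ℕ} (β : Fin k → V)
    (hB : B = SD ⊔ Submodule.span ℤ (Set.range β))
    (hrel : ∀ c : Fin k → ℤ, (∑ j, c j • β j) ∈ SD ↔ ∀ j, 2 ∣ c j) :
    (B ⧸ SD.comap B.subtype) ≃ₗ[ℤ] (Fin k → ZMod 2) :=
  ((quotMap β hB).quotKerEquivOfSurjective (quotMap_surjective β hB)).symm.trans
    ((Submodule.quotEquivOfEq _ _ (ker_quotMap β hB hrel)).trans (quotModTwoEquiv k))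

/-- THE COUNT: `B ⧸ (SD ∩ B)` has exactly `2 ^ k` elements. -/
theorem card_quotient_eq_two_pow {SD B : Submodule ℤ V} {k : ℕ} (β : Fin k → V)
    (hB : B = SD ⊔ Submodule.span ℤ (Set.range β))
    (hrel : ∀ c : Fin k → ℤ, (∑ j, c j • β j) ∈ SD ↔ ∀ j, 2 ∣ c j) :
    Nat.card (B ⧸ SD.comap B.subtype) = 2 ^ k := by
  rw [Nat.card_congr (quotientEquivModTwo β hB hrel).toEquiv, card_fin_zmod_two]

end General

end HodgeRepro0.P6AokiQuotient
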